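import Literature.Probability.RandomPlanarGeometry.ChordalCurveFamily
import Literature.Probability.RandomPlanarGeometry.ConformalRestrictionProofs
import Literature.Probability.RandomPlanarGeometry.RestrictionMeasuresSimpleHolds
import Literature.Probability.RandomPlanarGeometry.HexSAW
import Summits.CriticalPhenomena.SAWScalingLimit.Theses.SAWDevelopingMap

/-! Strategist s1 — census §Strengthen, S⁺₁ typed: exponent-free conformal restriction of the hexagonal SAW limit family. -/

namespace Summit.CriticalPhenomena.SAWScalingLimit.Cruxes.HexConjecture.StrategistS1

open Literature.Probability.RandomPlanarGeometry Literature.Probability.RandomPlanarGeometry.SAW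
open Literature.Probability.LatticeModels

/-- S⁺₁: there is a chordal, two-sided-restriction, conformally covariant family carried by simple curves to which the critical
hexagonal SAW converges for every Dobrushin domain and endpoint approximation (hex clone of `SAWConfRestriction.Target`). -/
def ConfRestrictionLimitHex : Prop :=
  ∃ P : Literature.Probability.RandomPlanarGeometry.ChordalFamily, P.IsChordal ∧ P.IsRestriction ∧ P.IsConformallyCovariant ∧ P.IsCarriedBySimpleCurves ∧ ∀ (D : Literature.Probability.RandomPlanarGeometry.DobrushinDomain) (a b : ℝ → Literature.Probability.LatticeModels.HexVertex), Literature.Probability.RandomPlanarGeometry.SAW.IsEmbEndpointApprox Literature.Probability.LatticeModels.hexGraph Literature.Probability.LatticeModels.hexCenter D a b → Literature.Probability.RandomPlanarGeometry.TendstoLaw (fun δ (γ : Literature.Probability.RandomPlanarGeometry.SAW.HexDomainSAW D.carrier δ (a δ) (b δ)) => γ.curve) (fun δ => Literature.Probability.RandomPlanarGeometry.SAW.hexSAWLaw D.carrier δ (a δ) (b δ)) id (P D)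

#check @Literature.Probability.RandomPlanarGeometry.IsRestrictionMeasure.eq_five_eighths_of_simple_holds

end Summit.CriticalPhenomena.SAWScalingLimit.Cruxes.HexConjecture.StrategistS1
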